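/-
Copyright: seat `ym-line-cbag-p2` (prover-ym-line-cbag-p2-g0-0), route `ColdBoxAllGroups`, crux `BulkAllGroups`
(stmt-QuantumFields-22255), line `dlr-chessboard-G` (skeleton `Cruxes/BulkAllGroups/Lines/birth.lean`).
-/
import Summits.QuantumFields.YangMills.Theorems.ColdBoxAllGroupsBulkAllGroupsCrudeGoodGaugeG
import Summits.QuantumFields.YangMills.Theorems.ColdBoxAllGroupsBoxFloorAllGroupsLargeFieldG
import Summits.QuantumFields.YangMills.Theorems.WeakCouplingRatesBulkDominatesColdBoxWCrudeGoodLargeField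

/-!
# Large fields inside the cold box are rare UNIFORMLY over crude-good boundary data, ANY compact gauge group — brick B5-G toward the
# open stubs N2-cov-G / N2-mean-G of crux `BulkAllGroups` (stmt-QuantumFields-22255); G-port of `…BulkDominatesColdBoxWCrudeGoodLargeField`

WHAT.  `boxKernelG_largeField_rarity_crudeGood`: for a compact `G` with a continuous unitary representation `ρ` of degree `N ≥ 1`,
`0 < θ`, `0 ≤ δ` and **`ε > 3θ + δ`**, for all large `β`, EVERY boundary datum `ω` with `CrudeGoodG ρ β δ ⌈β^θ⌉ ω` gives
`γ_Λ({∃ plaquette touching Λ of cost ≥ β^{2ε−1}} | ω) ≤ exp(−β^ε)`, `Λ = boxEdges 4 (2H+1)`, `γ_Λ(·|ω) = boxKernelG ρ β H ω`.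
The flat case `ω ≡ 1` (threshold `ε > 2θ`) is the sibling line's `boxState_largeField_rarity_of_rep` (S1 of crux 22254); the extra `θ + δ` is
the price of the small-link radius `a = 4(2H+3)√(2β^{2δ−1}) ≍ β^{θ+δ−1/2}` of a crude-good datum in comb gauge.

PROOF = B4-G (`exists_gauge_opDist1_le_of_crudeGoodG`) + the G-generic gauge covariance of the kernel (`integral_ymSpecification_gaugeTransformZd`)
+ quasilocality (`dependsOn_integral_ymSpecification`, `shift_mem_boxEdges_of_mem_collar`) + the G-generic ball-datum Gibbs bound B2
(`ymSpecification_ball_real_le`, operator-norm link balls, Haar small ball `haarReal_ball_ge_of_unitaryRep` with exponent `D = dim_ℝ 𝔤(ρ(G))`)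
+ the bookkeeping of the flat case (`eventually_neg_rpow_add_le` at `θ' = (3θ+δ)/2`; only constants see `N` and `D`).
NOT a claim about the mass gap; the Yang–Mills mass gap is NOT proved by any of this.
-/

set_option autoImplicit false

noncomputable section

open MeasureTheory Finset
open scoped Matrix.Norms.L2Operator
open Literature.Probability.LatticeModels (glueWith)
open Literature.MathematicalPhysics Literature.MathematicalPhysics.QuantumLattice
open Literature.MathematicalPhysics.QuantumFieldTheory
open Literature.MathematicalPhysics.QuantumFieldTheory.Balaban1983to89
open Literature.MathematicalPhysics.QuantumFieldTheory.Balaban1983to89.UnitaryModel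
open Literature.MathematicalPhysics.QuantumFieldTheory.Balaban1983to89.HaarSmallBallClosedSubgroup (haarReal_ball_ge_of_unitaryRep)
open Summit.QuantumFields.YangMills.Theorems.WeakCouplingRates

namespace Summit.QuantumFields.YangMills.Theorems.ColdBoxAllGroups

variable {N : ℕ} [NeZero N] {G : Type*} [Group G] [TopologicalSpace G] [IsTopologicalGroup G] [CompactSpace G]
  [MeasurableSpace G] [BorelSpace G] [SecondCountableTopology G]
variable (ρ : G →* Matrix (Fin N) (Fin N) ℂ) (hρu : ∀ g, ρ g ∈ Matrix.unitaryGroup (Fin N) ℂ) (hρc : Continuous ρ)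

/-! ### §2. The large-field event: gauge invariance and collar locality -/

omit [NeZero N] [TopologicalSpace G] [IsTopologicalGroup G] [CompactSpace G] [MeasurableSpace G] [BorelSpace G] [SecondCountableTopology G] in
/-- The large-field event «some plaquette touching `Λ` costs at least `s`» is gauge invariant (its indicator is). [folklore] -/
theorem isZdGaugeInvariant_indicator_largeFieldG (Λ : Finset (QuantumLattice.ZdEdge 4)) (s : ℝ) :
    IsZdGaugeInvariant
      ({U : LGConfig 4 G |
          ∃ p ∈ plaquettesTouching Λ, s ≤ (N : ℝ) - plaquetteObs ρ p.1 p.2.1.1 p.2.1.2 U}.indicator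
        (1 : LGConfig 4 G → ℝ)) := by
  intro g U
  have hiff : (gaugeTransformZd g U ∈ {U : LGConfig 4 G |
        ∃ p ∈ plaquettesTouching Λ, s ≤ (N : ℝ) - plaquetteObs ρ p.1 p.2.1.1 p.2.1.2 U}) ↔
      (U ∈ {U : LGConfig 4 G |
        ∃ p ∈ plaquettesTouching Λ, s ≤ (N : ℝ) - plaquetteObs ρ p.1 p.2.1.1 p.2.1.2 U}) := by
    simp only [Set.mem_setOf_eq, isZdGaugeInvariant_plaquetteObs ρ _ _ _ g U]
  by_cases hU : U ∈ {U : LGConfig 4 G |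
      ∃ p ∈ plaquettesTouching Λ, s ≤ (N : ℝ) - plaquetteObs ρ p.1 p.2.1.1 p.2.1.2 U}
  · rw [Set.indicator_of_mem hU, Set.indicator_of_mem (hiff.2 hU)]; rfl
  · rw [Set.indicator_of_notMem hU, Set.indicator_of_notMem (fun h => hU (hiff.1 h))]

omit [NeZero N] [TopologicalSpace G] [IsTopologicalGroup G] [CompactSpace G] [MeasurableSpace G] [BorelSpace G] [SecondCountableTopology G] in
/-- The indicator of the large-field event is a cylinder observable on the collar of `Λ`. [folklore] -/
theorem isCylinder_indicator_largeFieldG (Λ : Finset (QuantumLattice.ZdEdge 4)) (s : ℝ) :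
    IsCylinder
      ({U : LGConfig 4 G |
          ∃ p ∈ plaquettesTouching Λ, s ≤ (N : ℝ) - plaquetteObs ρ p.1 p.2.1.1 p.2.1.2 U}.indicator
        (1 : LGConfig 4 G → ℝ))
      ((plaquettesTouching Λ).biUnion plaquetteEdges) := by
  intro U V hUV
  have hiff : (U ∈ {U : LGConfig 4 G |
        ∃ p ∈ plaquettesTouching Λ, s ≤ (N : ℝ) - plaquetteObs ρ p.1 p.2.1.1 p.2.1.2 U}) ↔
      (V ∈ {U : LGConfig 4 G |
        ∃ p ∈ plaquettesTouching Λ, s ≤ (N : ℝ) - plaquetteObs ρ p.1 p.2.1.1 p.2.1.2 U}) := by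
    simp only [Set.mem_setOf_eq]
    refine exists_congr fun p => and_congr_right fun hp => ?_
    have h := isCylinder_plaquetteObs (G := G) ρ p
      (fun e he => hUV e (by
        rw [Finset.coe_biUnion]
        exact Set.mem_biUnion (Finset.mem_coe.2 hp) he))
    rw [h]
  by_cases hU : U ∈ {U : LGConfig 4 G |
      ∃ p ∈ plaquettesTouching Λ, s ≤ (N : ℝ) - plaquetteObs ρ p.1 p.2.1.1 p.2.1.2 U}
  · rw [Set.indicator_of_mem hU, Set.indicator_of_mem (hiff.1 hU)]; rfl
  · rw [Set.indicator_of_notMem hU, Set.indicator_of_notMem (fun h => hU (hiff.2 h))]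

/-! ### §3. Large fields are rare in the box, uniformly over crude-good data -/

include hρu hρc in
/-- **The Gibbs large-field bound in the box with a crude-good datum (explicit form)**, any compact `G`, unitary `ρ` of degree `N ≥ 1`,
`D = dim_ℝ 𝔤(ρ(G))`.  There is `c > 0` (the small-ball constant of `ρ(G)` inverted) such that for every `H`, every `β ≥ 1`, every `δ ≥ 0`,
every crude-good `ω` and every `s`:
`γ_Λ({∃ p touching Λ : cost_p ≥ s} | ω) ≤ e^{−βs} · e^{256 N (2H+3)² β^{2δ} · #Λ'} · (c (√β)^D)^{#Λ}`, `Λ = boxEdges 4 (2H+1)` — the small-link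
radius of the gauge-fixed datum being `a = 4(2H+3)√(2β^{2δ−1})` (`8 N β a² = 256 N (2H+3)² β^{2δ}`). [folklore] -/
theorem exists_boxKernelG_largeField_le_crudeGood :
    ∃ c : ℝ, 0 < c ∧ ∀ (H : ℕ) (β δ : ℝ), 1 ≤ β → 0 ≤ δ → ∀ ω : LGConfig 4 G,
      CrudeGoodG ρ β δ H ω → ∀ s : ℝ,
        (boxKernelG ρ β H ω).real
            {U | ∃ p ∈ plaquettesTouching (AxialGauge.boxEdges 4 (2 * H + 1)),
              s ≤ (N : ℝ) - plaquetteObs ρ p.1 p.2.1.1 p.2.1.2 U} ≤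
          Real.exp (-(β * s)) *
            Real.exp (256 * N * ((2 * H + 3 : ℕ) : ℝ) ^ 2 * β ^ (2 * δ) * #(plaquettesTouching (AxialGauge.boxEdges 4 (2 * H + 1)))) *
            (c * Real.sqrt β ^ Module.finrank ℝ (matrixLieAlgebra (Set.range ρ))) ^ #(AxialGauge.boxEdges 4 (2 * H + 1)) := by
  obtain ⟨c, hc, -, hball⟩ := haarReal_ball_ge_of_unitaryRep ρ hρc hρu (R := 1) one_pos
  refine ⟨c⁻¹, by positivity, ?_⟩
  intro H β δ hβ hδ ω hω s
  set D : ℕ := Module.finrank ℝ (matrixLieAlgebra (Set.range ρ)) with hD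
  set Λ := AxialGauge.boxEdges 4 (2 * H + 1) with hΛ
  have hβ0 : 0 < β := one_pos.trans_le hβ
  set E : Set (LGConfig 4 G) :=
    {U | ∃ p ∈ plaquettesTouching Λ, s ≤ (N : ℝ) - plaquetteObs ρ p.1 p.2.1.1 p.2.1.2 U} with hE
  have hEm : MeasurableSet E := measurableSet_exists_plaqCost_ge_of_rep ρ hρc Λ s
  have hFm : Measurable (E.indicator (1 : LGConfig 4 G → ℝ)) :=
    measurable_const.indicator hEm
  -- the gauge and the small-link datum
  set t : ℝ := β ^ (2 * δ - 1) with ht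
  have ht0 : 0 ≤ t := Real.rpow_nonneg hβ0.le _
  set a : ℝ := 4 * ((2 * H + 3 : ℕ) : ℝ) * Real.sqrt (2 * t) with ha
  have ha0 : 0 ≤ a := by positivity
  obtain ⟨g, hg⟩ := exists_gauge_opDist1_le_of_crudeGoodG ρ hρu hω
  set ω₁ : LGConfig 4 G := gaugeTransformZd g ω with hω₁
  set ω₂ : LGConfig 4 G := fun e =>
    if (e.1 + (fun _ => (1 : ℤ)), e.2) ∈ AxialGauge.boxEdges 4 (2 * H + 3) then ω₁ e else 1 with hω₂
  have hω₂ball : ∀ e, ‖ρ (ω₂ e) - 1‖ ≤ a := by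
    intro e
    by_cases he : (e.1 + (fun _ => (1 : ℤ)), e.2) ∈ AxialGauge.boxEdges 4 (2 * H + 3)
    · have h1 : ω₂ e = ω₁ e := by rw [hω₂]; exact if_pos he
      have h2 := hg (e.1 + fun _ => (1 : ℤ)) e.2 he
      rw [add_sub_cancel_right] at h2
      rw [h1]
      exact h2
    · have h1 : ω₂ e = 1 := by rw [hω₂]; exact if_neg he
      rw [h1, map_one, sub_self, norm_zero]; exact ha0
  -- (1) gauge invariance of the kernel probability
  have hstep1 : (boxKernelG ρ β H ω).real E = (ymSpecification ρ β Λ ω₁).real E := by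
    rw [← integral_indicator_one hEm, ← integral_indicator_one hEm]
    exact (integral_ymSpecification_gaugeTransformZd ρ hρc β Λ hFm (isZdGaugeInvariant_indicator_largeFieldG ρ Λ s) g ω).symm
  -- (2) quasilocality: the kernel reads only the collar, where `ω₁ = ω₂`
  have hstep2 : (ymSpecification ρ β Λ ω₁).real E = (ymSpecification ρ β Λ ω₂).real E := by
    rw [← integral_indicator_one hEm, ← integral_indicator_one hEm]
    have hdep := dependsOn_integral_ymSpecification ρ hρc β Λ hFm (isCylinder_indicator_largeFieldG ρ Λ s)
    refine hdep fun e he => ?_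
    rw [Finset.coe_union, Set.union_self, Finset.mem_coe] at he
    have hin : (e.1 + (fun _ => (1 : ℤ)), e.2) ∈ AxialGauge.boxEdges 4 (2 * H + 3) := shift_mem_boxEdges_of_mem_collar he
    show ω₁ e = ω₂ e
    rw [hω₂]; exact (if_pos hin).symm
  -- (3) the ball-datum Gibbs bound, Haar ball of radius `β^{-1/2} ≤ a`
  set q : ℝ := Real.sqrt β with hq
  have hq1 : 1 ≤ q := by rw [hq]; exact Real.one_le_sqrt.2 hβ
  have hq0 : 0 < q := one_pos.trans_le hq1
  set r₀ : ℝ := q⁻¹ with hr₀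
  have hr0 : 0 < r₀ := inv_pos.2 hq0
  have hr1 : r₀ ≤ 1 := inv_le_one_of_one_le₀ hq1
  haveI : (haarProbability G).IsMulLeftInvariant := by
    unfold haarProbability; infer_instance
  have hb : c * r₀ ^ D ≤ (haarProbability G).real {g | ‖ρ g - 1‖ ≤ r₀} := hball (haarProbability G) r₀ hr0 hr1
  have hcb : 0 < c * r₀ ^ D := by positivity
  have hr₀a : r₀ ≤ a := by
    -- `r₀ = √(β⁻¹) ≤ √(2t) ≤ a`
    have e1 : r₀ = Real.sqrt (β⁻¹) := by rw [hr₀, hq, Real.sqrt_inv]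
    have h1 : β⁻¹ ≤ 2 * t := by
      have h2 : β⁻¹ = β ^ (-(1 : ℝ)) := by rw [Real.rpow_neg hβ0.le, Real.rpow_one]
      have h3 : β ^ (-(1 : ℝ)) ≤ β ^ (2 * δ - 1) := Real.rpow_le_rpow_of_exponent_le hβ (by linarith)
      rw [h2]; linarith [Real.rpow_nonneg hβ0.le (2 * δ - 1)]
    have h4 : Real.sqrt (β⁻¹) ≤ Real.sqrt (2 * t) := Real.sqrt_le_sqrt h1
    have h5 : Real.sqrt (2 * t) ≤ a := by
      rw [ha]
      have h6 : (1 : ℝ) ≤ 4 * ((2 * H + 3 : ℕ) : ℝ) := by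
        have : (1 : ℝ) ≤ ((2 * H + 3 : ℕ) : ℝ) := by exact_mod_cast (show 1 ≤ 2 * H + 3 by omega)
        linarith
      nlinarith [Real.sqrt_nonneg (2 * t)]
    rw [e1]; exact h4.trans h5
  have hball' : c * r₀ ^ D ≤ (haarProbability G).real {g | ‖ρ g - 1‖ ≤ a} :=
    hb.trans (measureReal_mono (fun V (hV : ‖ρ V - 1‖ ≤ r₀) => hV.trans hr₀a))
  have hs : ∀ U ∈ E, s ≤ wilsonBoundaryAction ρ Λ U := fun U hU => le_wilsonBoundaryAction_of_exists_plaqCost_ge_of_rep ρ hρu hU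
  have key := ymSpecification_ball_real_le ρ hρu hρc hβ0.le Λ hEm hs hcb hball' hω₂ball
  rw [hstep1, hstep2]
  refine key.trans (le_of_eq ?_)
  -- bookkeeping
  have hβt : β * t = β ^ (2 * δ) := by
    rw [ht, show β * β ^ (2 * δ - 1) = β ^ (1 : ℝ) * β ^ (2 * δ - 1) by rw [Real.rpow_one], ← Real.rpow_add hβ0]
    congr 1; ring
  have ha2 : a ^ 2 = 16 * ((2 * H + 3 : ℕ) : ℝ) ^ 2 * (2 * t) := by
    rw [ha, mul_pow, mul_pow, Real.sq_sqrt (by positivity)]; norm_num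
  have e1 : β * (#(plaquettesTouching Λ) * (8 * (N : ℝ) * a ^ 2)) =
      256 * N * ((2 * H + 3 : ℕ) : ℝ) ^ 2 * β ^ (2 * δ) * #(plaquettesTouching Λ) := by
    rw [ha2]
    have : β * (#(plaquettesTouching Λ) * (8 * (N : ℝ) * (16 * ((2 * H + 3 : ℕ) : ℝ) ^ 2 * (2 * t)))) =
        256 * N * ((2 * H + 3 : ℕ) : ℝ) ^ 2 * (β * t) * #(plaquettesTouching Λ) := by ring
    rw [this, hβt]
  have e2 : (c * r₀ ^ D)⁻¹ = c⁻¹ * q ^ D := by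
    rw [hr₀, inv_pow, mul_inv, inv_inv]
  rw [e1, div_eq_mul_inv, ← inv_pow, e2]

include hρu hρc in
/-- **Large fields are rare in the box, UNIFORMLY over crude-good boundary data (one-scale form)**, any compact `G`, unitary `ρ` of
degree `N ≥ 1`.  For `0 < θ`, `0 ≤ δ` and `ε > 3θ + δ`: for all large `β` and every boundary datum `ω` with `CrudeGoodG ρ β δ ⌈β^θ⌉ ω`, the box
kernel `γ_Λ(·|ω) = boxKernelG ρ β ⌈β^θ⌉ ω` (`Λ = boxEdges 4 (2⌈β^θ⌉+1)`) gives the event «some plaquette touching the box costs at least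
`β^{2ε−1}`» probability at most `exp(−β^ε)`.  The flat datum needs only `ε > 2θ` (`boxState_largeField_rarity_of_rep`); the extra `θ + δ` pays
for the small-link radius `≍ β^{θ+δ−1/2}` of a crude-good datum in comb gauge (G-port of `boxKernel_largeField_rarity_crudeGood`). [folklore] -/
theorem boxKernelG_largeField_rarity_crudeGood {θ δ ε : ℝ} (hθ : 0 < θ) (hδ : 0 ≤ δ) (hε : 3 * θ + δ < ε) :
    ∃ β₀ : ℝ, ∀ β : ℝ, β₀ ≤ β → ∀ ω : LGConfig 4 G, CrudeGoodG ρ β δ ⌈β ^ θ⌉₊ ω →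
      (boxKernelG ρ β ⌈β ^ θ⌉₊ ω).real
          {U | ∃ p ∈ plaquettesTouching (AxialGauge.boxEdges 4 (2 * ⌈β ^ θ⌉₊ + 1)),
            β ^ (2 * ε - 1) ≤ (N : ℝ) - plaquetteObs ρ p.1 p.2.1.1 p.2.1.2 U} ≤
        Real.exp (-(β ^ ε)) := by
  obtain ⟨c, hc, hmain⟩ := exists_boxKernelG_largeField_le_crudeGood ρ hρu hρc
  set D : ℕ := Module.finrank ℝ (matrixLieAlgebra (Set.range ρ)) with hD
  -- θ' := (3θ + δ)/2: 4θ' = 6θ + 2δ, 2θ' = 3θ + δ < ε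
  have hθ' : 0 < (3 * θ + δ) / 2 := by linarith
  have hε' : 2 * ((3 * θ + δ) / 2) < ε := by linarith
  obtain ⟨β₀, hβ₀1, hasy⟩ := eventually_neg_rpow_add_le hθ' hε'
    (256 * N * 49 * 75000 + 2500 * |Real.log c|) (2500 * (D / 2)) (by positivity) (by positivity)
  refine ⟨β₀, fun β hβ ω hω => ?_⟩
  have hβ1 : 1 ≤ β := hβ₀1.trans hβ
  have hβ0 : 0 < β := one_pos.trans_le hβ1
  refine (hmain ⌈β ^ θ⌉₊ β δ hβ1 hδ ω hω (β ^ (2 * ε - 1))).trans ?_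
  set n : ℕ := 2 * ⌈β ^ θ⌉₊ + 1 with hn
  set Λ := AxialGauge.boxEdges 4 n with hΛ
  -- the box side in terms of β^θ
  have hX1 : 1 ≤ β ^ θ := Real.one_le_rpow hβ1 hθ.le
  have hc' : (⌈β ^ θ⌉₊ : ℝ) < β ^ θ + 1 := Nat.ceil_lt_add_one (by linarith)
  have hnR : (n : ℝ) ≤ 5 * β ^ θ := by rw [hn]; push_cast; nlinarith
  have hmR : ((2 * ⌈β ^ θ⌉₊ + 3 : ℕ) : ℝ) ≤ 7 * β ^ θ := by push_cast; nlinarith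
  have e4 : β ^ (4 * θ) = (β ^ θ) ^ 4 := by
    rw [← Real.rpow_natCast (β ^ θ) 4, ← Real.rpow_mul hβ0.le]; norm_num; ring_nf
  have e2θ : β ^ (2 * θ) = (β ^ θ) ^ 2 := by
    rw [← Real.rpow_natCast (β ^ θ) 2, ← Real.rpow_mul hβ0.le]; norm_num; ring_nf
  have hn4 : (n : ℝ) ^ 4 ≤ 625 * β ^ (4 * θ) := by
    rw [e4]
    calc (n : ℝ) ^ 4 ≤ (5 * β ^ θ) ^ 4 := pow_le_pow_left₀ (by positivity) hnR 4
      _ = 625 * (β ^ θ) ^ 4 := by ring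
  have hm2 : ((2 * ⌈β ^ θ⌉₊ + 3 : ℕ) : ℝ) ^ 2 ≤ 49 * β ^ (2 * θ) := by
    rw [e2θ]
    calc ((2 * ⌈β ^ θ⌉₊ + 3 : ℕ) : ℝ) ^ 2 ≤ (7 * β ^ θ) ^ 2 := pow_le_pow_left₀ (by positivity) hmR 2
      _ = 49 * (β ^ θ) ^ 2 := by ring
  have hΛR : (#Λ : ℝ) ≤ 2500 * β ^ (4 * θ) := by
    have h := card_boxEdges_four_le n
    calc (#Λ : ℝ) ≤ ((4 * n ^ 4 : ℕ) : ℝ) := by rw [hΛ]; exact_mod_cast h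
      _ = 4 * (n : ℝ) ^ 4 := by push_cast; ring
      _ ≤ 4 * (625 * β ^ (4 * θ)) := by linarith
      _ = 2500 * β ^ (4 * θ) := by ring
  have hΛ'R : (#(plaquettesTouching Λ) : ℝ) ≤ 75000 * β ^ (4 * θ) := by
    have h := card_plaquettesTouching_boxEdges_le n
    calc (#(plaquettesTouching Λ) : ℝ) ≤ ((120 * n ^ 4 : ℕ) : ℝ) := by rw [hΛ]; exact_mod_cast h
      _ = 120 * (n : ℝ) ^ 4 := by push_cast; ring
      _ ≤ 120 * (625 * β ^ (4 * θ)) := by linarith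
      _ = 75000 * β ^ (4 * θ) := by ring
  -- the base c (√β)³ as an exponential
  set A : ℝ := c * Real.sqrt β ^ D with hA
  have hA0 : 0 < A := by positivity
  have hlogA : Real.log A ≤ |Real.log c| + D / 2 * Real.log β := by
    rw [hA, Real.log_mul hc.ne' (by positivity), Real.log_pow, Real.log_sqrt hβ0.le]
    have := le_abs_self (Real.log c)
    have : (D : ℝ) * (Real.log β / 2) = D / 2 * Real.log β := by ring
    linarith
  have hpow : A ^ #Λ = Real.exp (#Λ * Real.log A) := by
    rw [Real.exp_nat_mul, Real.exp_log hA0]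
  have hs : β * β ^ (2 * ε - 1) = β ^ (2 * ε) := by
    rw [show β * β ^ (2 * ε - 1) = β ^ (1 : ℝ) * β ^ (2 * ε - 1) by rw [Real.rpow_one],
      ← Real.rpow_add hβ0]; congr 1; ring
  rw [hpow, ← Real.exp_add, ← Real.exp_add, hs]
  refine Real.exp_le_exp.2 ?_
  have hlog0 : 0 ≤ Real.log β := Real.log_nonneg hβ1
  have hY0 : 0 ≤ β ^ (4 * θ) := Real.rpow_nonneg hβ0.le _
  have hZ0 : 0 ≤ β ^ (2 * δ) := Real.rpow_nonneg hβ0.le _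
  -- the middle term: 256N (2H+3)² β^{2δ} #Λ' ≤ 256N·49·75000 β^{6θ+2δ}
  have hN0 : (0 : ℝ) ≤ N := Nat.cast_nonneg _
  have e6 : β ^ (2 * θ) * β ^ (2 * δ) * β ^ (4 * θ) = β ^ (4 * ((3 * θ + δ) / 2)) := by
    rw [← Real.rpow_add hβ0, ← Real.rpow_add hβ0]; congr 1; ring
  have hmid : 256 * N * ((2 * ⌈β ^ θ⌉₊ + 3 : ℕ) : ℝ) ^ 2 * β ^ (2 * δ) * #(plaquettesTouching Λ) ≤
      256 * N * 49 * 75000 * β ^ (4 * ((3 * θ + δ) / 2)) := by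
    rw [← e6]
    have h1 : ((2 * ⌈β ^ θ⌉₊ + 3 : ℕ) : ℝ) ^ 2 * β ^ (2 * δ) ≤ 49 * β ^ (2 * θ) * β ^ (2 * δ) :=
      mul_le_mul_of_nonneg_right hm2 hZ0
    have h2 : ((2 * ⌈β ^ θ⌉₊ + 3 : ℕ) : ℝ) ^ 2 * β ^ (2 * δ) * #(plaquettesTouching Λ) ≤
        (49 * β ^ (2 * θ) * β ^ (2 * δ)) * (75000 * β ^ (4 * θ)) :=
      mul_le_mul h1 hΛ'R (Nat.cast_nonneg _) (by positivity)
    have h3 : 256 * (N : ℝ) * ((2 * ⌈β ^ θ⌉₊ + 3 : ℕ) : ℝ) ^ 2 * β ^ (2 * δ) * #(plaquettesTouching Λ) =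
        256 * N * (((2 * ⌈β ^ θ⌉₊ + 3 : ℕ) : ℝ) ^ 2 * β ^ (2 * δ) * #(plaquettesTouching Λ)) := by ring
    rw [h3, show 256 * (N : ℝ) * 49 * 75000 * (β ^ (2 * θ) * β ^ (2 * δ) * β ^ (4 * θ)) =
      256 * N * ((49 * β ^ (2 * θ) * β ^ (2 * δ)) * (75000 * β ^ (4 * θ))) by ring]
    exact mul_le_mul_of_nonneg_left h2 (by positivity)
  -- the last term: #Λ log A ≤ 2500 β^{4θ}(|log c| + 3/2 log β) ≤ the same with β^{4θ'} (4θ ≤ 4θ')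
  have h4θ : β ^ (4 * θ) ≤ β ^ (4 * ((3 * θ + δ) / 2)) := Real.rpow_le_rpow_of_exponent_le hβ1 (by linarith)
  have h3 : (#Λ : ℝ) * Real.log A ≤ 2500 * β ^ (4 * ((3 * θ + δ) / 2)) * (|Real.log c| + D / 2 * Real.log β) := by
    calc (#Λ : ℝ) * Real.log A ≤ #Λ * (|Real.log c| + D / 2 * Real.log β) :=
          mul_le_mul_of_nonneg_left hlogA (Nat.cast_nonneg _)
      _ ≤ 2500 * β ^ (4 * θ) * (|Real.log c| + D / 2 * Real.log β) :=
          mul_le_mul_of_nonneg_right hΛR (by positivity)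
      _ ≤ 2500 * β ^ (4 * ((3 * θ + δ) / 2)) * (|Real.log c| + D / 2 * Real.log β) :=
          mul_le_mul_of_nonneg_right (mul_le_mul_of_nonneg_left h4θ (by norm_num)) (by positivity)
  have h4 := hasy β hβ
  nlinarith [h3, h4, hmid, abs_nonneg (Real.log c), Real.rpow_nonneg hβ0.le (4 * ((3 * θ + δ) / 2))]

end Summit.QuantumFields.YangMills.Theorems.ColdBoxAllGroups

end
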